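import Literature.AnabelianGeometry.EtaleTheta.ThetaRigidity
import Literature.AnabelianGeometry.EtaleTheta.Discharge.Sec2EnvelopeLemmas
import Mathlib.Topology.Algebra.OpenSubgroup

/-!
# [EtTh] §2 light discharge over `ThetaEnvData` / `RigidData` (proof-only companion)
# Prop 2.12 (ii) ⟺ (i); Cor 2.18 (iv) fibres, existence half; Cor 2.18 (ii) from Prop 2.14 (ii)

Mochizuki, *The Étale Theta Function …* [EtTh], Publ. RIMS 45 (2009), §2, Prop 2.12 pp.45–46,
Def 2.13 (ii) p.47, Cor 2.18 (ii), (iv) pp.60–63 (locators `p.N` = PDF pages of the PRIMS text;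
bib key `MochizukiEtTh2009`). PROOF-ONLY companion (no `def`, no new named fact) of
`ThetaRigidity.lean` / `MonoThetaEnv.lean` (seat abc-iut-L2-t2; nothing there is edited or
restated), unit W2-L2-06 (abc-iut-L2-t10). What is proved, from the interface axioms alone:

* `RigidData.prop212_ii_iff_prop212_i` — **Prop 2.12 (ii) ⟺ Prop 2.12 (i)** ("Assertion (ii)
  follows formally from assertion (i)", p.46): in `Δ_X[μ_N] = Δ_X × μ_N` one has
  `[Δ_X[μ_N], Δ_X[μ_N]] = s^alg([Δ_X, Δ_X])` and `s^alg(A) ∩ (s^alg(B)·μ_N) = s^alg(A ∩ B)`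
  (`Discharge/Sec2EnvelopeLemmas.lean`), so the intersection of (ii) is
  `s^alg(([Δ_X,Δ_X]·Ker) ∩ l·Δ_Θ)`, which is `s^alg(l·Δ_Θ)` iff `l·Δ_Θ ⊆ [Δ_X,Δ_X]·Ker`.
* `ThetaEnvData.exists_modelIso_of_aut` — Def 2.13 (ii) bookkeeping: a bi-continuous automorphism
  of `Π^tp_Y[μ_N]` normalising `D_Y`, fixing `μ_N` pointwise and carrying `Im(s^Θ_η)` onto
  `Im(s^Θ_{η'})` is an isomorphism of models `M(η) ≃ M(η')` (transport along an automorphism of the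
  group itself is conjugation in `Out`: `TopOut.transport_mk_eq_conj`).
* `ThetaEnvData.exists_iso_eq_twist`, `RigidData.cor218_iv_fibre_twists` — **Cor 2.18 (iv), fibres,
  existence half**: for every `φ ∈ Hom(Π^tp_Y/Π^tp_Ÿ, μ_N)` the twist `x ↦ φ(x̄)·x` IS an
  automorphism of the model `M_N` inducing the identity on `Π^tp_Y` (p.63) — the second conjunct
  of the named fact `RigidData.Cor218_iv_fibre`. Inputs: `[Π^tp_Y : Π^tp_Ÿ] = 2`, `Π^tp_Ÿ` open and
  normal in `Π^tp_X`, `μ_N` cyclic and discrete (fields of `ThetaEnvData`).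
* `RigidData.cor218_ii_of_prop214_ii` — **Cor 2.18 (ii) from Prop 2.14 (ii)** ("precisely the
  content of Proposition 2.14, (ii)", p.61), using the interface axiom
  `RigidData.thetaSections_conj` ("the various `s^Θ_Ÿ` … are obtained as `Π^tp_X[μ_N]`-conjugates
  of any given `s^Θ_Ÿ`", p.46).

NOT derivable from the interface axioms (reported on STATUS, not proved): Prop 2.12 (i) itself
(it IS the geometric input "`l·Δ_Θ ⊆ [Δ^Θ,Δ^Θ]`", theta-group structure, p.45); Prop 2.14 (i),
(iii), Rmk 2.14.1; the first conjunct of Cor 2.18 (iv) fibres. Cor 2.18/2.19 are FACT-policy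
nodes of the cell; the Cor 2.18 items above are consistency checks of the typing, proved in passing.
-/

namespace Literature.AnabelianGeometry.EtaleTheta

universe u

/-! ## Transport along an automorphism of the topological group itself -/

section TransportConj

variable {A : Type*} [Group A] [TopologicalSpace A]

/-- Conjugating `Aut_top(A)` by `c ∈ Aut_top(A)` (viewed as an isomorphism `A ≃ₜ* A`) is
conjugation by `c`. [cite: MochizukiEtTh2009, Def 2.13(ii) p.47] -/
theorem conjContAut_mk_apply (c φ : contMulAut A) :
    conjContAut (ContinuousMulEquiv.mk (c : MulAut A) c.2.1 c.2.2) φ = c * φ * c⁻¹ := by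
  apply Subtype.ext
  apply MulEquiv.ext
  intro x
  rfl

/-- **Transport along an automorphism of the topological group itself is conjugation in `Out`**:
`TopOut.transport c = conj([c])`. [cite: MochizukiEtTh2009, Def 2.13(ii) p.47] -/
theorem TopOut.transport_mk_eq_conj (c : contMulAut A) :
    TopOut.transport (ContinuousMulEquiv.mk (c : MulAut A) c.2.1 c.2.2) =
      (MulAut.conj (TopOut.mk A c)).toMonoidHom := by
  refine MonoidHom.ext fun x => ?_
  obtain ⟨φ, rfl⟩ := QuotientGroup.mk_surjective x
  change TopOut.transport _ (TopOut.mk A φ) = TopOut.mk A c * TopOut.mk A φ * (TopOut.mk A c)⁻¹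
  rw [← map_mul, ← map_inv, ← map_mul, ← conjContAut_mk_apply]
  rfl

end TransportConj

/-! ## Proposition 2.12 (ii) ⟺ (i) -/

namespace RigidData

variable {N : ℕ+} {l : ℕ} (R : RigidData.{u} N l)

/-- The intersection of Prop 2.12 (ii), computed in `Π^tp_X[μ_N] = μ_N ⋊ Π^tp_X`:
`([Δ_X[μ_N], Δ_X[μ_N]] · s^alg(Ker)) ∩ (s^alg(l·Δ_Θ) · μ_N) = s^alg(([Δ_X, Δ_X] · Ker) ∩ l·Δ_Θ)`.
[cite: MochizukiEtTh2009, Prop 2.12(ii) p.45] -/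
theorem prop212_ii_lhs_eq :
    (⁅CycEnvelope.deltaEnv R.aug R.chi, CycEnvelope.deltaEnv R.aug R.chi⁆ ⊔ R.algImageX R.thetaKer) ⊓
        (R.algImageX R.lDeltaTheta ⊔ (CycEnvelope.proj R.aug R.chi).ker) =
      R.algImageX ((⁅R.aug.ker, R.aug.ker⁆ ⊔ R.thetaKer) ⊓ R.lDeltaTheta) := by
  simp only [algImageX]
  rw [CycEnvelope.commutator_deltaEnv, ← Subgroup.map_sup,
    CycEnvelope.map_algSection_inf_map_sup_ker]

/-- **Proposition 2.12 (ii) ⟺ Proposition 2.12 (i)** over `RigidData` ("Assertion (ii) follows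
formally from assertion (i)", p.46; the converse holds as well).
[cite: MochizukiEtTh2009, Prop 2.12(ii) p.45] -/
theorem prop212_ii_iff_prop212_i : R.Prop212_ii ↔ R.Prop212_i := by
  unfold Prop212_ii Prop212_i
  rw [prop212_ii_lhs_eq]
  simp only [algImageX]
  rw [(Subgroup.map_injective (CycEnvelope.algSection_injective R.aug R.chi)).eq_iff, inf_eq_right]

/-- **Proposition 2.12 (ii) DISCHARGED modulo Proposition 2.12 (i)**.
[cite: MochizukiEtTh2009, Prop 2.12(ii) p.45] -/
theorem prop212_ii_of_prop212_i (h : R.Prop212_i) : R.Prop212_ii :=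
  R.prop212_ii_iff_prop212_i.mpr h

end RigidData

/-! ## Isomorphisms of model mono-theta environments from automorphisms of `Π^tp_Y[μ_N]` -/

namespace ThetaEnvData

variable {N : ℕ+} (T : ThetaEnvData.{u} N)

/-- `D_Y` is normalised by `[c] ∈ Out(Π^tp_Y[μ_N])` as soon as `[c]` commutes with the generators of
`D_Y` (Kummer shifts and `Gal(Y/X)`-conjugations, Def 2.13 (i)).
[cite: MochizukiEtTh2009, Def 2.13(i) p.47] -/
theorem DY_map_conj_eq_of_commute (c : contMulAut T.env)
    (hc : ∀ d ∈ T.kummerOut ∪ T.galOut, TopOut.mk _ c * d = d * TopOut.mk _ c) :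
    T.DY.map (MulAut.conj (TopOut.mk _ c)).toMonoidHom = T.DY := by
  unfold DY
  rw [MonoidHom.map_closure]
  congr 1
  refine (Set.EqOn.image_eq (f₂ := id) fun d hd => ?_).trans (Set.image_id _)
  change TopOut.mk _ c * d * (TopOut.mk _ c)⁻¹ = d
  rw [hc d hd, mul_inv_cancel_right]

/-- **Def 2.13 (ii) bookkeeping**: a bi-continuous automorphism `c` of `Π^tp_Y[μ_N]` whose class
normalises `D_Y`, which fixes `μ_N` pointwise and carries `Im(s^Θ_η)` onto `Im(s^Θ_{η'})`, underlies
an isomorphism of the model mono-theta environments `M(η) ≃ M(η')`.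
[cite: MochizukiEtTh2009, Def 2.13(ii) p.47] -/
theorem exists_modelIso_of_aut {η η' : T.PiYdd → T.mu} (hη : η ∈ T.thetaCocycles)
    (hη' : η' ∈ T.thetaCocycles) (c : contMulAut T.env)
    (hD : T.DY.map (MulAut.conj (TopOut.mk _ c)).toMonoidHom = T.DY)
    (hμ : ∀ a, (c : MulAut T.env) (CycEnvelope.inMu T.augY T.chi a) = CycEnvelope.inMu T.augY T.chi a)
    (hs : (T.sTheta hη).range.map (c : MulAut T.env).toMonoidHom = (T.sTheta hη').range) :
    ∃ α : (T.modelMono hη).Iso (T.modelMono hη'), ∀ x, α.e x = (c : MulAut T.env) x := by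
  refine ⟨{ e := ContinuousMulEquiv.mk (c : MulAut T.env) c.2.1 c.2.2
            map_D := ?_
            map_sTheta := ?_ }, fun x => rfl⟩
  · change T.DY.map _ = T.DY
    rw [TopOut.transport_mk_eq_conj]
    exact hD
  · change (fun H : Subgroup T.env => H.map (c : MulAut T.env).toMonoidHom) ''
        CycEnvelope.muConjClass T.augY T.chi (T.sTheta hη).range =
      CycEnvelope.muConjClass T.augY T.chi (T.sTheta hη').range
    rw [CycEnvelope.image_muConjClass_eq T.augY T.chi _ hμ, hs]

/-! ## Cor 2.18 (iv), fibres: the twists by `Hom(Π^tp_Y/Π^tp_Ÿ, μ_N)` (existence half) -/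

/-- A homomorphism `φ : Π^tp_Y → μ_N` killing `Π^tp_Ÿ` takes values killed by `2`
(`[Π^tp_Y : Π^tp_Ÿ] = 2`). [cite: MochizukiEtTh2009, Cor 2.18(iv) p.63] -/
theorem hom_mul_self_eq_one (φ : T.PiY →* T.mu) (hφ : ∀ g : T.PiYdd, φ (T.inclYdd g) = 1)
    (h : T.PiY) : φ h * φ h = 1 := by
  rw [← map_mul]
  have hmem : h * h ∈ T.PiYdd.subgroupOf T.PiY :=
    (Subgroup.mul_mem_iff_of_index_two T.index_PiYdd).mpr Iff.rfl
  rw [Subgroup.mem_subgroupOf] at hmem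
  exact hφ ⟨(h * h : T.PiY), hmem⟩

/-- … hence its values are fixed by the cyclotomic character (`μ_N` is cyclic, and an automorphism
of a cyclic group fixes the `2`-torsion). [cite: MochizukiEtTh2009, Cor 2.18(iv) p.63] -/
theorem chi_apply_hom_eq (φ : T.PiY →* T.mu) (hφ : ∀ g : T.PiYdd, φ (T.inclYdd g) = 1)
    (x : T.PiX) (h : T.PiY) : T.chi (T.aug x) (φ h) = φ h := by
  haveI := T.mu_cyclic
  exact mulEquiv_apply_eq_self_of_mul_self_eq_one _ (T.hom_mul_self_eq_one φ hφ h)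

/-- The `χ ∘ aug_Y`-invariance of the values of `φ`, in the form consumed by `CycEnvelope.twist`.
[cite: MochizukiEtTh2009, Cor 2.18(iv) p.63] -/
theorem chi_hom_inv (φ : T.PiY →* T.mu) (hφ : ∀ g : T.PiYdd, φ (T.inclYdd g) = 1) :
    ∀ g h : T.PiY, T.chi (T.augY g) (φ h) = φ h :=
  fun g h => T.chi_apply_hom_eq φ hφ g h

/-- `φ` is invariant under conjugation by `Π^tp_X` (`Π^tp_Ÿ` is normal in `Π^tp_X`, of index `2` in
`Π^tp_Y`, and `ℤ/2ℤ` has no non-trivial automorphism). [cite: MochizukiEtTh2009, Cor 2.18(iv) p.63] -/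
theorem hom_conj_eq (φ : T.PiY →* T.mu) (hφ : ∀ g : T.PiYdd, φ (T.inclYdd g) = 1)
    (x : T.PiX) (h : T.PiY) :
    φ ⟨x * h * x⁻¹, T.PiY_normal.conj_mem _ h.2 x⟩ = φ h := by
  rw [← mul_inv_eq_one, ← map_inv, ← map_mul]
  have hmem : (⟨x * h * x⁻¹, T.PiY_normal.conj_mem _ h.2 x⟩ * h⁻¹ : T.PiY) ∈
      T.PiYdd.subgroupOf T.PiY := by
    rw [Subgroup.mul_mem_iff_of_index_two T.index_PiYdd, Subgroup.mem_subgroupOf,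
      Subgroup.mem_subgroupOf]
    change x * h * x⁻¹ ∈ T.PiYdd ↔ ((h : T.PiX)⁻¹ : T.PiX) ∈ T.PiYdd
    rw [inv_mem_iff]
    constructor
    · intro hx
      simpa [mul_assoc] using T.PiYdd_normal.conj_mem _ hx x⁻¹
    · intro hh
      exact T.PiYdd_normal.conj_mem _ hh x
  rw [Subgroup.mem_subgroupOf] at hmem
  exact hφ ⟨_, hmem⟩

/-- `φ` is continuous (`Π^tp_Ÿ` is open; `μ_N` is discrete).
[cite: MochizukiEtTh2009, Cor 2.18(iv) p.63] -/
theorem continuous_hom (φ : T.PiY →* T.mu) (hφ : ∀ g : T.PiYdd, φ (T.inclYdd g) = 1) :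
    Continuous φ := by
  have hker : IsOpen ((φ.ker : Subgroup T.PiY) : Set T.PiY) := by
    refine Subgroup.isOpen_mono (H₁ := T.PiYdd.subgroupOf T.PiY) ?_ ?_
    · intro h hh
      rw [Subgroup.mem_subgroupOf] at hh
      rw [MonoidHom.mem_ker]
      exact hφ ⟨_, hh⟩
    · exact T.PiYdd_open.preimage continuous_subtype_val
  rw [continuous_discrete_rng]
  intro b
  by_cases hb : ∃ h₀ : T.PiY, φ h₀ = b
  · obtain ⟨h₀, rfl⟩ := hb
    have : φ ⁻¹' {φ h₀} = (fun h => h₀⁻¹ * h) ⁻¹' (φ.ker : Set T.PiY) := by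
      ext h
      simp only [Set.mem_preimage, Set.mem_singleton_iff, SetLike.mem_coe, MonoidHom.mem_ker,
        map_mul, map_inv, inv_mul_eq_one]
      exact eq_comm
    rw [this]
    exact hker.preimage (by fun_prop)
  · have : φ ⁻¹' {b} = ∅ := by
      ext h
      simp only [Set.mem_preimage, Set.mem_singleton_iff, Set.mem_empty_iff_false, iff_false]
      exact fun hh => hb ⟨h, hh⟩
    rw [this]
    exact isOpen_empty

/-- The twist of `Π^tp_Y[μ_N]` by `φ ∈ Hom(Π^tp_Y/Π^tp_Ÿ, μ_N)` (`CycEnvelope.twist`) is bi-continuous.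
[cite: MochizukiEtTh2009, Cor 2.18(iv) p.63] -/
theorem twist_mem_contMulAut (φ : T.PiY →* T.mu) (hφ : ∀ g : T.PiYdd, φ (T.inclYdd g) = 1) :
    CycEnvelope.twist T.augY T.chi φ (T.chi_hom_inv φ hφ) ∈ contMulAut T.env := by
  have hc : Continuous φ := T.continuous_hom φ hφ
  have hl : Continuous fun x : T.env => x.left :=
    (continuous_fst.comp continuous_induced_dom :
      Continuous (Prod.fst ∘ fun x : T.env => (x.left, x.right)))
  have hr : Continuous fun x : T.env => x.right :=
    (continuous_snd.comp continuous_induced_dom :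
      Continuous (Prod.snd ∘ fun x : T.env => (x.left, x.right)))
  refine ⟨?_, ?_⟩
  · refine continuous_induced_rng.2 ?_
    change Continuous fun x : T.env => ((φ x.right * x.left, x.right) : T.mu × T.PiY)
    exact ((hc.comp hr).mul hl).prodMk hr
  · refine continuous_induced_rng.2 ?_
    change Continuous fun x : T.env => (((φ x.right)⁻¹ * x.left, x.right) : T.mu × T.PiY)
    exact ((hc.comp hr).inv.mul hl).prodMk hr

/-- The class of the twist commutes with the generators of `D_Y`.
[cite: MochizukiEtTh2009, Cor 2.18(iv) p.63] -/
theorem twist_commute_generators (φ : T.PiY →* T.mu) (hφ : ∀ g : T.PiYdd, φ (T.inclYdd g) = 1) :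
    ∀ d ∈ T.kummerOut ∪ T.galOut,
      TopOut.mk _ ⟨_, T.twist_mem_contMulAut φ hφ⟩ * d =
        d * TopOut.mk _ ⟨_, T.twist_mem_contMulAut φ hφ⟩ := by
  rintro d (⟨δ, hδ, hc, rfl⟩ | ⟨g, hc, rfl⟩)
  · rw [← map_mul, ← map_mul]
    congr 1
    apply Subtype.ext
    exact CycEnvelope.twist_shift_comm φ (T.chi_hom_inv φ hφ) hδ
  · rw [← map_mul, ← map_mul]
    congr 1
    apply Subtype.ext
    change CycEnvelope.twist T.augY T.chi φ (T.chi_hom_inv φ hφ) * T.conjX g =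
      T.conjX g * CycEnvelope.twist T.augY T.chi φ (T.chi_hom_inv φ hφ)
    ext x
    · change φ ⟨g * (x.right : T.PiX) * g⁻¹, _⟩ * T.chi (T.aug g) x.left =
        T.chi (T.aug g) (φ x.right * x.left)
      rw [map_mul, T.chi_apply_hom_eq φ hφ, T.hom_conj_eq φ hφ]
    · rfl

/-- **Cor 2.18 (iv), fibres, existence half DISCHARGED** over `ThetaEnvData`: every
`φ ∈ Hom(Π^tp_Y/Π^tp_Ÿ, μ_N)` yields an automorphism `α` of the model `M(η)` with `α(x) = φ(x̄)·x`
(so `α` induces the identity on `Π^tp_Y` and on `μ_N`): the twist fixes `μ_N` and `Im(s^Θ_η)`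
pointwise and centralises the generators of `D_Y`. [cite: MochizukiEtTh2009, Cor 2.18(iv) p.63] -/
theorem exists_iso_eq_twist {η : T.PiYdd → T.mu} (hη : η ∈ T.thetaCocycles) (φ : T.PiY →* T.mu)
    (hφ : ∀ g : T.PiYdd, φ (T.inclYdd g) = 1) :
    ∃ α : (T.modelMono hη).Iso (T.modelMono hη), ∀ x : T.env,
      α.e x = CycEnvelope.inMu T.augY T.chi (φ (CycEnvelope.proj T.augY T.chi x)) * x := by
  obtain ⟨α, hα⟩ := T.exists_modelIso_of_aut hη hη ⟨_, T.twist_mem_contMulAut φ hφ⟩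
    (T.DY_map_conj_eq_of_commute _ (T.twist_commute_generators φ hφ))
    (fun a => CycEnvelope.twist_inMu φ (T.chi_hom_inv φ hφ) a)
    (by
      rw [MonoidHom.map_range]
      congr 1
      refine MonoidHom.ext fun g => ?_
      change CycEnvelope.twist T.augY T.chi φ (T.chi_hom_inv φ hφ) (T.sTheta hη g) = T.sTheta hη g
      exact CycEnvelope.twist_apply_of_eq_one φ (T.chi_hom_inv φ hφ) (hφ g))
  refine ⟨α, fun x => ?_⟩
  rw [hα]
  exact CycEnvelope.twist_eq_inMu_mul φ (T.chi_hom_inv φ hφ) x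

end ThetaEnvData

namespace RigidData

variable {N : ℕ+} {l : ℕ} (R : RigidData.{u} N l)

/-- **Cor 2.18 (iv), fibres — the second conjunct of the named fact `RigidData.Cor218_iv_fibre`
DISCHARGED**: the twists by `Hom(Π^tp_Y/Π^tp_Ÿ, μ_N)` are automorphisms of the model. The first
conjunct (every automorphism inducing the identity on `Π^tp_Y` is `μ_N`-conjugate to a twist) is
not derivable from the interface axioms and is not claimed here.
[cite: MochizukiEtTh2009, Cor 2.18(iv) p.63] -/
theorem cor218_iv_fibre_twists :
    ∀ (η : R.PiYdd → R.mu) (hη : η ∈ R.thetaCocycles) (φ : R.PiY →* R.mu),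
      (∀ g : R.PiYdd, φ (R.inclYdd g) = 1) →
      ∃ α : (R.modelMono hη).Iso (R.modelMono hη),
        ∀ x : R.env,
          α.e x = CycEnvelope.inMu R.augY R.chi (φ (CycEnvelope.proj R.augY R.chi x)) * x :=
  fun _ hη φ hφ => R.toThetaEnvData.exists_iso_eq_twist hη φ hφ

/-! ## Cor 2.18 (ii) from Prop 2.14 (ii) -/

/-- **Cor 2.18 (ii) DISCHARGED modulo Prop 2.14 (ii)** ("the existence of [such] isomorphisms …
is precisely the content of Proposition 2.14, (ii)", p.61): all theta sections of the collection
are `K^×, (l·ℤ)`-conjugate (`RigidData.thetaSections_conj`, p.46), and the extended shift `α_δ`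
supplied by Prop 2.14 (ii) is an isomorphism `M(η) ≃ M(η')` inducing the identity on `Π^tp_Y`.
[cite: MochizukiEtTh2009, Cor 2.18(ii) p.60] -/
theorem cor218_ii_of_prop214_ii (h214 : R.Prop214_ii) : R.Cor218_ii := by
  intro η η' hη hη'
  obtain ⟨δ, hδ, hc, hs, hD⟩ := h214 η hη _ (R.thetaSections_conj η η' hη hη')
  obtain ⟨α, hα⟩ := R.toThetaEnvData.exists_modelIso_of_aut hη hη' ⟨_, hc⟩ hD
    (fun a => CycEnvelope.shift_inMu hδ a) (by
      rw [MonoidHom.map_range]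
      congr 1
      exact MonoidHom.ext hs)
  refine ⟨α, fun x => ?_⟩
  rw [hα]
  exact CycEnvelope.proj_shift hδ x

end RigidData

end Literature.AnabelianGeometry.EtaleTheta
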